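import Mathlib
import Summits.NavierStokesRegularity.OSWSelfSimilar.HouLuoViscousThetaFloor
import HarnessLib

/-!
# Viscous Hou–Luo profile MODEL: the constant-viscosity rescaled flow has no growing fixed point

HONEST FRAMING (cell ns-blowup GROUP B, zone Z3, case Z3-HL-T2; human rulings D-0035/D-0074): **1-D MODEL calculus;
not Euler, not Navier–Stokes; «violates: none — MODEL».** Companion corollary of `HouLuoViscousThetaFloor.lean`
(the floor `2c_ω ≤ c_l`), written to give the refuter's K-item K2 (STATUS K-BLOCK on PREREG-HL-T2) a name.

OBJECT. The CONSTANT-ν dynamic rescaling of the viscous Hou–Luo model (SHEET.md §12, engine Z3-HLT2) evolves the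
rescaled viscosity by `d ln ε/dτ = 2c_l − c_ω` (`ε = ν C_l²/C_ω`). A FIXED POINT of that flow is a frozen-`ε` sheet point
with, in addition, `2c_l − c_ω = 0`. In the blow-up sector `c_ω > 0` this exponent ratio `c_l = c_ω/2` lies strictly
below the floor `2c_ω` of `HouLuoViscousThetaFloor.two_comega_le_cl`, so:

* `cl_lt_two_comega_of_fixed` — `2c_l = c_ω` and `0 < c_ω` give `c_l < 2c_ω` (arithmetic);
* `no_growing_fixed_point` — under the hypotheses of `trivial_of_cl_lt_two_comega` (C² profiles, `Θ, Ω → 0` at `±∞`,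
  `F₁ ≡ 0` with `b = 0`, the `Θ`-equation with `c_θ = 2c_ω − c_l`, `ε_ω, ε_θ ≥ 0`, any drift/`HΩ`/advection knob)
  a fixed point of the constant-`ν` rescaled flow with `c_ω > 0` is trivial: `Θ ≡ 0`, `Ω ≡ 0`.

So the registered outcome set of the (D) experiment {ARREST, non-self-similar blow-up, no clean law} is exactly the
kernel-compatible one; the DECAYING late states found numerically (`c_ω < 0`, `c_l/c_ω → ½`) are outside the floor's
hypothesis `c_ω > 0` and are not constrained here. Nothing in this file asserts anything about the dynamics itself.
bears_on: LADDER-NS N5 / zone Z3 → N1 linear core; SELFSIM-NOGO (M8) MODEL side.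
-/

noncomputable section
open Set Filter Topology

namespace Summit.NavierStokesRegularity.OSWSelfSimilar
namespace HouLuoConstantNuRescaling

open HouLuoOriginLaws (F1)
open HouLuoViscousThetaFloor (FTheta trivial_of_cl_lt_two_comega)

/-- At a fixed point of `d ln ε/dτ = 2c_l − c_ω` in the blow-up sector (`2c_l = c_ω`, `0 < c_ω`) the exponent lies below
the floor: `c_l < 2c_ω`. [new here — MODEL arithmetic] -/
theorem cl_lt_two_comega_of_fixed {cω cl : ℝ} (hfix : 2 * cl = cω) (hcω : 0 < cω) : cl < 2 * cω := by
  linarith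

/-- The fixed-point exponent itself: `2c_l = c_ω` iff `c_l = c_ω/2` (the constant-`ν` self-consistency ratio; gauge
`c_ω = 1`: `c_l = ½`, tree `Literature.Analysis.FluidPDE.effectiveViscosity_half`). [new here — MODEL arithmetic] -/
theorem fixed_iff_half (cω cl : ℝ) : 2 * cl = cω ↔ cl = cω / 2 := by
  constructor <;> intro h <;> linarith

/-- **No growing fixed point of the constant-`ν` rescaled Hou–Luo flow.** A `C²` decaying solution `(Ω, Θ)` of the
frozen-`ε` viscous Hou–Luo profile system (`F₁ ≡ 0` with `b = 0` and temperature forcing `P = Θ′`; the `Θ`-equation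
`FΘ ≡ 0` with `c_θ = 2c_ω − c_l`; `ε_ω, ε_θ ≥ 0`; any `a`, `𝒰`, `HΩ`) that is ALSO stationary for the rescaled viscosity,
`2c_l = c_ω`, with `c_ω > 0`, is trivial. (Corollary of `HouLuoViscousThetaFloor.trivial_of_cl_lt_two_comega`.)
[new here — MODEL] -/
theorem no_growing_fixed_point (cω cl a εω εθ : ℝ) (H U Om dOm ddOm Θ P dP : ℝ → ℝ) (hεω : 0 ≤ εω)
    (hεθ : 0 ≤ εθ) (hcω : 0 < cω) (hfix : 2 * cl = cω)
    (hF1 : ∀ ξ, F1 cω cl a 0 εω H U Om dOm ddOm P ξ = 0)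
    (hFΘ : ∀ ξ, FTheta (2 * cω - cl) cl a εθ U Θ P dP ξ = 0)
    (hOm : ∀ x, HasDerivAt Om (dOm x) x) (hdOm : ∀ x, HasDerivAt dOm (ddOm x) x)
    (hΘ : ∀ x, HasDerivAt Θ (P x) x) (hP : ∀ x, HasDerivAt P (dP x) x)
    (hOm0 : Tendsto Om (cocompact ℝ) (𝓝 0)) (hΘ0 : Tendsto Θ (cocompact ℝ) (𝓝 0)) : Θ = 0 ∧ Om = 0 :=
  trivial_of_cl_lt_two_comega cω cl a εω εθ H U Om dOm ddOm Θ P dP hεω hεθ hcω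
    (cl_lt_two_comega_of_fixed hfix hcω) hF1 hFΘ hOm hdOm hΘ hP hOm0 hΘ0

end HouLuoConstantNuRescaling
end Summit.NavierStokesRegularity.OSWSelfSimilar
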